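import Summits.Langlands.Langlands.Theses.DyadicOddResidue
import Literature.NumberTheory.GaloisRepresentations.ModPGaloisRep

/-!
# `DyadicEisensteinFM` (stmt-Langlands-18741) — negative knowledge III: at `ℓ = 2` the mod-`ℓ`
# cyclotomic character is trivial and mod-`ℓ` characters kill complex conjugation

Support lemmas of the standing disprover (`Cruxes/DyadicEisensteinFM/Disproof.lean`, cycle 1,
§0b; refuter-cdisprove-stmt-Langlands-18741-0, 2026-08-17), on the residual hypothesis
`¬ ρ.IsResiduallyAbsIrreducible` (the Eisenstein residue `ρ̄^ss = χ̄₁ ⊕ χ̄₂`) of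
`Summit.Langlands.Langlands.Theses.DyadicOddResidue.DyadicEisensteinFM` at its prime `ℓ = 2`.

The route's second named obstruction is "`ω ≡ 1 (mod 2)` makes every reducible block
exceptional".  Typed: `(ℤ/2)ˣ = 1` (`units_zmod_two_eq_one`), so the mod-`2` cyclotomic character
`modPCyclotomicCharacterZMod K 2 : Γ_K →* (ℤ/2)ˣ` of ANY field `K` of characteristic `≠ 2` is
the trivial character (`modPCyclotomicCharacterZMod_two_eq_one`, `…_two_rat`): Paškūnas's
trichotomy of reducible blocks `χ̄₁χ̄₂⁻¹ ∈ {1, ω̄, ω̄⁻¹}` / generic collapses at `2` to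
`χ̄₁ = χ̄₂` / `χ̄₁ ≠ χ̄₂`.  Moreover every character `χ̄ : Γ_K →* kˣ` with `char k = 2` is trivial on
complex conjugation (`character_complexConjugation_eq_one`: `x² = 1 ⟹ x = 1` in characteristic
`2`), so the residual characters of the Eisenstein residue satisfy `χ̄ᵢ(c) = 1` and `ρ̄^ss(c) = 1`
identically — companion to `Negative/OddnessResiduallyInvisible.lean`.

Nothing here asserts a route statement. [folklore]
-/

set_option linter.dupNamespace false -- project-wide option; `Summit.Langlands.Langlands` is the mandated namespace

noncomputable section

open Literature.NumberTheory.GaloisRepresentations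

namespace Summit.Langlands.Langlands.Theorems.DyadicEisensteinFM.Negative

/-- `(ℤ/2)ˣ` is the trivial group. [folklore] -/
theorem units_zmod_two_eq_one (u : (ZMod 2)ˣ) : u = 1 := by
  revert u
  decide

/-- **`ω̄ ≡ 1` at `ℓ = 2`**: the mod-`2` cyclotomic character of any field of characteristic `≠ 2`
is trivial (it is valued in `(ℤ/2)ˣ = 1`). [folklore] -/
theorem modPCyclotomicCharacterZMod_two_eq_one (K : Type*) [Field K] [NeZero ((2 : ℕ) : K)] :
    modPCyclotomicCharacterZMod K 2 = 1 :=
  MonoidHom.ext fun σ => by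
    rw [MonoidHom.one_apply]
    exact units_zmod_two_eq_one _

/-- In particular `ω̄₂ = 1` on `Γ_ℚ`. [folklore] -/
theorem modPCyclotomicCharacterZMod_two_rat : modPCyclotomicCharacterZMod ℚ 2 = 1 :=
  modPCyclotomicCharacterZMod_two_eq_one ℚ

/-- **Mod-`2` characters kill complex conjugation**: for `char k = 2`, every character
`χ : Γ_K →* kˣ` is trivial on every complex conjugation `c` (an involution,
`IsComplexConjugation.sq_eq_one`; and `x² = 1 ⟹ (x - 1)² = 0 ⟹ x = 1` in characteristic `2`).
Hence `ρ̄^ss(c) = 1` on the Eisenstein residue `χ̄₁ ⊕ χ̄₂`, for odd and even `ρ` alike. [folklore] -/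
theorem character_complexConjugation_eq_one {K : Type*} [Field K] {k : Type*} [Field k]
    [CharP k 2] (χ : Field.absoluteGaloisGroup K →* kˣ) {φ : K →+* ℝ}
    {c : Field.absoluteGaloisGroup K} (hc : IsComplexConjugation φ c) : χ c = 1 := by
  have hu : χ c ^ 2 = 1 := by rw [← map_pow, hc.sq_eq_one, map_one]
  set x : k := ((χ c : kˣ) : k) with hxdef
  have hx : x ^ 2 = 1 := by
    have h := congrArg Units.val hu
    simpa [hxdef] using h
  have h0 : (x - 1) ^ 2 = 0 := by
    rw [sub_sq, hx, CharTwo.two_eq_zero, zero_mul, zero_mul, sub_zero, one_pow,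
      CharTwo.add_self_eq_zero]
  have hx1 : x = 1 := sub_eq_zero.mp ((pow_eq_zero_iff two_ne_zero).mp h0)
  exact Units.ext (by rw [Units.val_one]; exact hx1)

end Summit.Langlands.Langlands.Theorems.DyadicEisensteinFM.Negative

end
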